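import Summits.FinalStateConjecture.FinalStateConjecture.Theses.CurvatureOrSymmetry
import Summits.FinalStateConjecture.FinalStateConjecture.Theorems.PhotonSphereChannelsTameCensorshipReduction

/-!
# Route CurvatureOrSymmetry — `LocalExitSuffices` (item `stmt-FinalStateConjecture-9938`)

`LocalExitSuffices_proof : Theses.CurvatureOrSymmetry.LocalExitSuffices`: a LOCAL good exit through
a datum `D` (a jointly smooth injective admissible one-parameter family `F` with `F 0 = D` whose
members with `0 < ‖c‖ < ε` avoid the exceptional set `𝓔`) is turned into a GLOBAL one (all members
with `c ≠ 0` avoid `𝓔`) by the reparametrisation `F ∘ σ` with the squashing map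
`σ c = (ε · arctan(c₀) / 2) e₀` of `ℝ¹ = EuclideanSpace ℝ (Fin 1)`: smooth, injective, `σ 0 = 0`,
`‖σ c‖ = |ε · arctan(c₀) / 2| < ε`. Both ingredients are REUSED from the landed helper file
`Theorems/PhotonSphereChannelsTameCensorshipReduction.lean` (§3 there):
`PhotonSphereChannels.squash_spec` (the four properties of `σ`, with the bound in the form
`|(σ c)₀| < ε`) and `PhotonSphereChannels.isSmoothDataFamily_comp` (precomposition with a smooth
parameter map preserves `IsSmoothDataFamily`). The only new step is `‖σ c‖ = |(σ c)₀|` on `ℝ¹`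
(`norm_smul`, `PiLp.norm_single`). Pure calculus and logic; Christodoulou, CQG 16 (1999)
A23, p. A24, only motivates the notion of a family through `D`.
-/

-- every `Summit.FinalStateConjecture.FinalStateConjecture.…` name repeats the summit = sub-problem
-- segment (D-0017 layout, CONVENTIONS §2); the duplicate is deliberate.
set_option linter.dupNamespace false

noncomputable section

namespace Summit.FinalStateConjecture.FinalStateConjecture.Theorems

open Literature.Geometry.Lorentzian
open scoped Manifold ContDiff Topology

/-- **`LocalExitSuffices` (item `stmt-FinalStateConjecture-9938` of route `CurvatureOrSymmetry`)
holds.** If through `D` passes a jointly smooth injective admissible one-parameter family `F`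
(`F 0 = D`) whose members with `0 < ‖c‖ < ε` avoid `𝓔`, then the reparametrised family `F ∘ σ`,
`σ c = (ε · arctan(c₀) / 2) e₀` (`PhotonSphereChannels.squash_spec`), is again jointly smooth
(`PhotonSphereChannels.isSmoothDataFamily_comp`), injective, passes through `D` at `0`, stays
admissible, and ALL its members with `c ≠ 0` avoid `𝓔`, because `σ c ≠ 0` and
`‖σ c‖ = |ε · arctan(c₀) / 2| < ε`. -/
theorem LocalExitSuffices_proof :
    Summit.FinalStateConjecture.FinalStateConjecture.Theses.CurvatureOrSymmetry.LocalExitSuffices := by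
  unfold Theses.CurvatureOrSymmetry.LocalExitSuffices
  intro X _ _ _ _ _ _ 𝓔 D hloc
  obtain ⟨F, hF, h0, hinj, hadm, ε, hε, hgood⟩ := hloc
  obtain ⟨hσs, hσi, hσ0, hσlt⟩ := PhotonSphereChannels.squash_spec hε
  set σ : EuclideanSpace ℝ (Fin 1) → EuclideanSpace ℝ (Fin 1) :=
    fun c ↦ (ε * Real.arctan (c 0) / 2) • EuclideanSpace.single (0 : Fin 1) (1 : ℝ) with hσ
  have hσ0' : σ 0 = 0 := hσ0
  have hσne : ∀ c, c ≠ 0 → σ c ≠ 0 := fun c hc h' ↦ hc (hσi (h'.trans hσ0'.symm))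
  -- on `ℝ¹` the norm of `σ c = t • e₀` is `|t|`, and `squash_spec` bounds `|(σ c)₀| = |t|` by `ε`
  have hσnorm : ∀ c, ‖σ c‖ < ε := fun c ↦ by
    have h := hσlt c
    simp only [PiLp.smul_apply, PiLp.single_apply, if_true, smul_eq_mul, mul_one] at h
    have hn : ‖σ c‖ = |ε * Real.arctan (c 0) / 2| := by
      simp only [hσ, norm_smul, PiLp.norm_single, norm_one, mul_one, Real.norm_eq_abs]
    exact hn ▸ h
  refine ⟨F ∘ σ, PhotonSphereChannels.isSmoothDataFamily_comp hF hσs, ?_, hinj.comp hσi,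
    fun c ↦ hadm _, fun c hc ↦ hgood _ (hσne c hc) (hσnorm c)⟩
  show F (σ 0) = D
  rw [hσ0', h0]

end Summit.FinalStateConjecture.FinalStateConjecture.Theorems

end
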